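import Literature.Topology.FourManifolds.SmaleDiffDisc
import Mathlib.Analysis.SpecialFunctions.SmoothTransition
import HarnessLib

/-!
# Smale's theorem at a small scale (annulus twist, layer 2)

Auxiliary file (layer 2) of helper `helper_sliceGluing_annulusTwist`, line `Sketch`, crux
`SblfDescent.RungOne`.

(Crux item stmt-SmoothPoincare4-18531; skeleton `Cruxes/RungOne/Lines/Sketch.lean`.)

Smale's theorem (S. Smale, *Diffeomorphisms of the 2-sphere* (1959), Thm. B; J. Cerf, LNM 53
(1968), Appendice §5, Théorème 4; tree `unitBallDiffeotopyTrivial_euclideanSpace_two`,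
`SmaleDiffDisc.lean`) joins a diffeomorphism of `ℝ²` supported in the unit disc to the identity
through such diffeomorphisms.  Here it is read at an arbitrary small scale `μ` and as plain
jointly smooth families of maps: given a diffeomorphism `ψ` of `ℝ²` equal to the identity off
the disc of radius `7/4`, its conjugate `ψ_λ = δ_λ ∘ ψ ∘ δ_λ⁻¹` by the homothety of ratio
`λ = 4μ/7` is the end of a jointly smooth family `D_t` of diffeomorphisms of `ℝ²`, all equal to
the identity off the disc of radius `μ`, with `D_t = id` for `t ≤ 0` and `D_t = ψ_λ` for
`t ≥ 1` (`AnnulusTwist.exists_smale_family`).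

## References

* S. Smale, *Diffeomorphisms of the 2-sphere*, Proc. AMS 10 (1959) 621–626, Thm. B. [Smale1959]
* J. Cerf, *Sur les difféomorphismes de la sphère de dimension trois (Γ₄ = 0)*, LNM 53 (1968),
  Appendice §5, Théorème 4. [CerfDiffeoSphere1968]
-/

set_option linter.dupNamespace false

noncomputable section

open scoped ContDiff Topology Manifold
open Set Function Metric Literature.Topology.FourManifolds

namespace Summit.SmoothPoincare4.SmoothPoincare4.Cruxes.RungOne.Sketch

namespace AnnulusTwist

/-- The stages of a diffeotopy of `ℝ²` are jointly smooth in the vector-space sense, and so are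
the inverse stages (adapted from `contDiff_toFun_invFun_of_diffeotopy`, `SphereDiffeoLoops.lean`).
[folklore] -/
theorem contDiff_of_diffeotopy (L : Diffeotopy 𝓘(ℝ, EuclideanSpace ℝ (Fin 2)) (EuclideanSpace ℝ (Fin 2))) :
    (ContDiff ℝ ∞ fun q : ℝ × EuclideanSpace ℝ (Fin 2) => L.toFun q.1 q.2) ∧
      ContDiff ℝ ∞ fun q : ℝ × EuclideanSpace ℝ (Fin 2) => L.invFun q.1 q.2 := by
  -- adapted from SphereDiffeoLoops.lean (`contDiff_toFun_invFun_of_diffeotopy`)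
  constructor
  · have h := L.contMDiff_uncurry_toFun
    rw [← modelWithCornersSelf_prod, chartedSpaceSelf_prod] at h
    exact contMDiff_iff_contDiff.1 h
  · have h := L.contMDiff_uncurry_invFun
    rw [← modelWithCornersSelf_prod, chartedSpaceSelf_prod] at h
    exact contMDiff_iff_contDiff.1 h

/-- **Smale's theorem at scale `μ`, as plain families.** Let `ψ` be a smooth map of `ℝ²` with
smooth two-sided inverse `ψ'`, equal to the identity off the disc of radius `7/4`, and `μ > 0`.
Then with `λ = 4μ/7` there are jointly smooth, mutually inverse families `D_t`, `D_t⁻¹` of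
self-maps of `ℝ²` with `D_t = id` for `t ≤ 0`, `D_t z = λ ψ (λ⁻¹ z)` for `t ≥ 1`, and
`D_t z = z` whenever `μ ≤ ‖z‖`. [cite: CerfDiffeoSphere1968, Appendice §5, Théorème 4] -/
theorem exists_smale_family (ψ ψ' : EuclideanSpace ℝ (Fin 2) → EuclideanSpace ℝ (Fin 2))
    (hψ : ContDiff ℝ ∞ ψ) (hψ' : ContDiff ℝ ∞ ψ') (h1 : ∀ z, ψ (ψ' z) = z) (h2 : ∀ z, ψ' (ψ z) = z)
    (hsupp : ∀ z, 7 / 4 ≤ ‖z‖ → ψ z = z) {μ : ℝ} (hμ : 0 < μ) :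
    ∃ D Dinv : ℝ → EuclideanSpace ℝ (Fin 2) → EuclideanSpace ℝ (Fin 2),
      ContDiff ℝ ∞ (uncurry D) ∧ ContDiff ℝ ∞ (uncurry Dinv) ∧
      (∀ t z, D t (Dinv t z) = z) ∧ (∀ t z, Dinv t (D t z) = z) ∧
      (∀ t ≤ (0 : ℝ), ∀ z, D t z = z) ∧
      (∀ t, (1 : ℝ) ≤ t → ∀ z, D t z = (4 * μ / 7) • ψ ((4 * μ / 7)⁻¹ • z)) ∧
      (∀ t z, μ ≤ ‖z‖ → D t z = z) := by
  -- the unit-scale conjugate `ψ₁ = δ_{4/7} ∘ ψ ∘ δ_{7/4}`, supported in the unit disc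
  have h47 : (4 / 7 : ℝ) ≠ 0 := by norm_num
  let s : EuclideanSpace ℝ (Fin 2) ≃ₘ⟮𝓘(ℝ, EuclideanSpace ℝ (Fin 2)), 𝓘(ℝ, EuclideanSpace ℝ (Fin 2))⟯
      EuclideanSpace ℝ (Fin 2) :=
    { toFun := fun z => (4 / 7 : ℝ) • ψ ((4 / 7 : ℝ)⁻¹ • z)
      invFun := fun z => (4 / 7 : ℝ) • ψ' ((4 / 7 : ℝ)⁻¹ • z)
      left_inv := fun z => by simp [smul_smul, h2]
      right_inv := fun z => by simp [smul_smul, h1]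
      contMDiff_toFun := by
        show ContMDiff _ _ _ (fun z : EuclideanSpace ℝ (Fin 2) => (4 / 7 : ℝ) • ψ ((4 / 7 : ℝ)⁻¹ • z))
        exact ((hψ.comp (contDiff_id.const_smul (4 / 7 : ℝ)⁻¹)).const_smul (4 / 7 : ℝ)).contMDiff
      contMDiff_invFun := by
        show ContMDiff _ _ _ (fun z : EuclideanSpace ℝ (Fin 2) => (4 / 7 : ℝ) • ψ' ((4 / 7 : ℝ)⁻¹ • z))
        exact ((hψ'.comp (contDiff_id.const_smul (4 / 7 : ℝ)⁻¹)).const_smul (4 / 7 : ℝ)).contMDiff }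
  have hs_apply : ∀ z, s z = (4 / 7 : ℝ) • ψ ((4 / 7 : ℝ)⁻¹ • z) := fun z => rfl
  have hs1 : ∀ y : EuclideanSpace ℝ (Fin 2), 1 ≤ ‖y‖ → s y = y := by
    intro y hy
    rw [hs_apply, hsupp _ ?_, smul_smul]; · norm_num
    rw [norm_smul, Real.norm_eq_abs, abs_of_pos (by norm_num)]
    nlinarith
  obtain ⟨D₀, hD₀1, hD₀supp⟩ := unitBallDiffeotopyTrivial_euclideanSpace_two s hs1
  -- reparametrise: stationary outside `[0, 1]`
  set D₁ := D₀.reparam Real.smoothTransition Real.smoothTransition.contDiff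
    Real.smoothTransition.zero with hD₁
  have hD₁t : ∀ t z, D₁.toFun t z = D₀.toFun (Real.smoothTransition t) z := fun t z => rfl
  have hD₁i : ∀ t z, D₁.invFun t z = D₀.invFun (Real.smoothTransition t) z := fun t z => rfl
  obtain ⟨hc1, hc2⟩ := contDiff_of_diffeotopy D₁
  have hD₀one : ∀ z, D₀.toFun 1 z = s z := fun z => by
    rw [← Diffeotopy.coe_stage, hD₀1]
  -- scale down by `μ`
  refine ⟨fun t z => μ • D₁.toFun t (μ⁻¹ • z), fun t z => μ • D₁.invFun t (μ⁻¹ • z), ?_, ?_, ?_,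
    ?_, ?_, ?_, ?_⟩
  · show ContDiff ℝ ∞ fun q : ℝ × EuclideanSpace ℝ (Fin 2) => μ • D₁.toFun q.1 (μ⁻¹ • q.2)
    exact (hc1.comp (contDiff_fst.prodMk (contDiff_snd.const_smul μ⁻¹))).const_smul μ
  · show ContDiff ℝ ∞ fun q : ℝ × EuclideanSpace ℝ (Fin 2) => μ • D₁.invFun q.1 (μ⁻¹ • q.2)
    exact (hc2.comp (contDiff_fst.prodMk (contDiff_snd.const_smul μ⁻¹))).const_smul μ
  · intro t z
    simp only [smul_smul, inv_mul_cancel₀ hμ.ne', one_smul, Diffeotopy.toFun_invFun,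
      mul_inv_cancel₀ hμ.ne']
  · intro t z
    simp only [smul_smul, inv_mul_cancel₀ hμ.ne', one_smul, Diffeotopy.invFun_toFun,
      mul_inv_cancel₀ hμ.ne']
  · intro t ht z
    simp only [hD₁t, Real.smoothTransition.zero_of_nonpos ht, D₀.toFun_zero, id, smul_smul,
      mul_inv_cancel₀ hμ.ne', one_smul]
  · intro t ht z
    simp only [hD₁t, Real.smoothTransition.one_of_one_le ht, hD₀one, hs_apply, smul_smul]
    congr 1
    · ring
    · congr 1; rw [← mul_inv]; congr 1; ring
  · intro t z hz
    simp only [hD₁t]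
    rw [hD₀supp, smul_smul, mul_inv_cancel₀ hμ.ne', one_smul]
    rw [norm_smul, Real.norm_eq_abs, abs_inv, abs_of_pos hμ]
    rw [le_inv_mul_iff₀ hμ, mul_one]
    exact hz

end AnnulusTwist

/-- **Registered sub-helper `helper_ann_smale`** (layer 2 of `helper_sliceGluing_annulusTwist`):
Smale's theorem for the plane at scale `μ`, as plain jointly smooth families
(`AnnulusTwist.exists_smale_family`). [cite: CerfDiffeoSphere1968, Appendice §5, Théorème 4] -/
theorem helper_ann_smale : ∀ (ψ ψ' : EuclideanSpace ℝ (Fin 2) → EuclideanSpace ℝ (Fin 2)), ContDiff ℝ ∞ ψ → ContDiff ℝ ∞ ψ' → (∀ z, ψ (ψ' z) = z) → (∀ z, ψ' (ψ z) = z) → (∀ z, 7 / 4 ≤ ‖z‖ → ψ z = z) → ∀ (μ : ℝ), 0 < μ → ∃ D Dinv : ℝ → EuclideanSpace ℝ (Fin 2) → EuclideanSpace ℝ (Fin 2), ContDiff ℝ ∞ (Function.uncurry D) ∧ ContDiff ℝ ∞ (Function.uncurry Dinv) ∧ (∀ t z, D t (Dinv t z) = z) ∧ (∀ t z, Dinv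 t (D t z) = z) ∧ (∀ t ≤ (0 : ℝ), ∀ z, D t z = z) ∧ (∀ t, (1 : ℝ) ≤ t → ∀ z, D t z = (4 * μ / 7) • ψ ((4 * μ / 7)⁻¹ • z)) ∧ (∀ t z, μ ≤ ‖z‖ → D t z = z) :=
  fun ψ ψ' hψ hψ' h1 h2 hsupp _ hμ => AnnulusTwist.exists_smale_family ψ ψ' hψ hψ' h1 h2 hsupp hμ

end Summit.SmoothPoincare4.SmoothPoincare4.Cruxes.RungOne.Sketch

end
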